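import Summits.HubbardSuperconductivity.HubbardSuperconductivity.Theses.CooperPairDMottWalk

/-!
# Route `CooperPairDMottWalk`: the glue items `CruxesGiveTarget` (stmt-HubbardSuperconductivity-14352),
# `TargetSuffices` (stmt-HubbardSuperconductivity-14353) and `Assembly` (stmt-HubbardSuperconductivity-1182)

Pure logic over the route's statements (the `let CP` Cooper-pair predicate and the breathing family
`let Hb` are syntactically identical in all of them):

* `cruxesGiveTarget_proof : CruxesGiveTarget` — `CooperPairDMott → BindingWalk → PureCooperPair`:
  `CooperPairDMott` at `U₀ = 2 ∈ [2, 4]` is the antecedent of `BindingWalk`, whose consequent is the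
  body of `PureCooperPair`.
* `targetSuffices_proof : TargetSuffices` — `PureCooperPair → DiluteBECBridge → HubbardSuperconductivity`:
  the target gives `U ∈ [2, 8]` with the pure-model Cooper-pair data, the bridge at that `U` gives
  `δ ∈ (0, 1/2)` with the summit's long-range-order clause, and `0 < 2 ≤ U`.
* `cooperPairDMottWalk_assembly_proof : Assembly` — their composition
  (`CooperPairDMott → BindingWalk → DiluteBECBridge → HubbardSuperconductivity`).

Sources: the route card (planner Sketch.lean, 2026-08-16); D. P. Arovas, E. Berg, S. A. Kivelson,
S. Raghu, Annu. Rev. Condens. Matter Phys. 13 (2022) 239. No definition is introduced.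
-/

set_option linter.dupNamespace false

namespace Summit.HubbardSuperconductivity.HubbardSuperconductivity.Theorems.CooperPairDMottWalk

open Summit.HubbardSuperconductivity.HubbardSuperconductivity.Theses.CooperPairDMottWalk

/-- **`CruxesGiveTarget` holds** (route `CooperPairDMottWalk`, item `stmt-HubbardSuperconductivity-14352`):
`CooperPairDMott → BindingWalk → PureCooperPair` — instantiate the Mott-corner crux at `U₀ = 2` and
feed it to the walk. [folklore] -/
theorem cruxesGiveTarget_proof : CruxesGiveTarget := fun hD hW =>
  hW ⟨2, ⟨le_rfl, by norm_num⟩, hD 2 ⟨le_rfl, by norm_num⟩⟩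

/-- **`TargetSuffices` holds** (route `CooperPairDMottWalk`, item `stmt-HubbardSuperconductivity-14353`):
`PureCooperPair → DiluteBECBridge → HubbardSuperconductivity` — the bridge turns the pure-model Cooper
pair at `U ∈ [2, 8]` into `d`-wave pair-field long-range order at some doping `δ ∈ (0, 1/2)`, which is
the summit's body with `0 < 2 ≤ U`. [folklore] -/
theorem targetSuffices_proof : TargetSuffices := by
  intro hX hB
  unfold _root_.HubbardSuperconductivity Literature.Hubbard.DWaveSuperconductivityHubbard
  obtain ⟨U, hU, hCP⟩ := hX
  obtain ⟨δ, hδ, H⟩ := hB U hU hCP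
  exact ⟨U, by linarith [hU.1], δ, hδ, H⟩

/-- **Route CooperPairDMottWalk's `Assembly` holds** (item `stmt-HubbardSuperconductivity-1182`):
`CooperPairDMott → BindingWalk → DiluteBECBridge → HubbardSuperconductivity`, as
`targetSuffices_proof (cruxesGiveTarget_proof hD hW) hB`. [folklore] -/
theorem cooperPairDMottWalk_assembly_proof : Assembly := fun hD hW hB =>
  targetSuffices_proof (cruxesGiveTarget_proof hD hW) hB

end Summit.HubbardSuperconductivity.HubbardSuperconductivity.Theorems.CooperPairDMottWalk
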